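import Summits.PneNP.PneNP.Theses.ReslinSizeFromWidth
import Literature.Computability.MetaComplexity.RandomCNFResolutionProofs

/-!
# PneNP / ReslinSizeFromWidth — `RandomThreeCnfExpandsAndUnsat` (stmt-PneNP-18935): random
3-CNFs are whp unsatisfiable cover expanders

Route `PneNP/ReslinSizeFromWidth`, support item stmt-PneNP-18935: for every integer density
`c ≥ 6` there is `ε > 0` such that `φ ∼ F₃(n, cn)` (`randomKCNF 3 n (c * n)`) is, with
probability `→ 1`, UNSATISFIABLE and has `(εn, 7/4)`-COVER-EXPANDING clause scopes.

This is the probabilistic half of the tree's Chvátal–Szemerédi proof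
(`Literature.Computability.MetaComplexity.chvatal_szemeredi_holds`, `RandomCNFResolutionProofs`)
with the resolution part removed: the first-moment bound `card_le_of_forall_satisfiable`
(`2 (7/8)^c ≤ 2 (7/8)^6 < 1`, via `two_mul_pow_lt_one_of_density` at `0.7 · 2³ = 5.6 ≤ 6 ≤ c`)
and the fixed-radius expansion count `card_le_of_forall_not_isCoverExpander_linear` with
`a = (2·3+1)/4 = 7/4`, `B = e^{1+a} c a`, `κ = 1/(a (2B)^4)`, radius `⌊κn⌋` (hence radius `κn`
for integer cardinalities), glued by `randomKCNF_toOuterMeasure_ge` and a squeeze in `ℝ≥0∞`;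
`ε = κ`. Together with `WidthFromVertexExpansion` (stmt-PneNP-18934) it yields: whp every Res(⊕)
refutation of a random 3-CNF of density `c ≥ 6` has a line of rank `> 7κn/8 · 3/4 / …` — the
route's glue `closes` performs exactly this combination.

References: V. Chvátal, E. Szemerédi, J. ACM 35 (1988), Theorem (§1) [ChvatalSzemeredi1988];
E. Ben-Sasson, A. Wigderson, J. ACM 48 (2001), §6 (expansion of random CNFs)
[BenSassonWigderson2001].
-/

namespace Summit.PneNP.PneNP.Theorems

-- `Summit.PneNP.PneNP` repeats a path component by design (summit = sub-problem); silence the linter.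
set_option linter.dupNamespace false

open Finset Filter Literature.Computability.Complexity Literature.Computability.MetaComplexity
open scoped Topology ENNReal

/-- **`RandomThreeCnfExpandsAndUnsat`** (item stmt-PneNP-18935): for every integer density
`c ≥ 6` there is `ε > 0` (here `ε = κ = 1/(a(2B)^4)`, `a = 7/4`, `B = e^{1+a} c a`) with
`Pr_{φ ∼ F₃(n, cn)}[φ unsatisfiable ∧ (εn, 7/4)-cover expanding] → 1`. First moment +
fixed-radius expansion count, as in the tree's Chvátal–Szemerédi proof.
[ChvatalSzemeredi1988, Theorem (§1); BenSassonWigderson2001, §6] -/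
theorem randomThreeCnfExpandsAndUnsat_proof :
    Summit.PneNP.PneNP.Theses.ReslinSizeFromWidth.RandomThreeCnfExpandsAndUnsat := by
  unfold Summit.PneNP.PneNP.Theses.ReslinSizeFromWidth.RandomThreeCnfExpandsAndUnsat
  intro c hc6
  classical
  -- constants (`k = 3`)
  have hk : (3 : ℕ) ≤ 3 := le_rfl
  have hc6' : (6 : ℝ) ≤ c := by exact_mod_cast hc6
  have hc : (0.7 : ℝ) * 2 ^ (3 : ℕ) ≤ (c : ℕ) := by norm_num; linarith
  set a : ℝ := (2 * ((3 : ℕ) : ℝ) + 1) / 4 with ha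
  have ha74 : a = 7 / 4 := by rw [ha]; norm_num
  have ha74' : (7 : ℝ) / 4 ≤ a := by rw [ha74]
  set B : ℝ := Real.exp (1 + a) * c * a with hB
  set κ : ℝ := 1 / (a * (2 * B) ^ 4) with hκ
  set r : ℝ := 2 * (1 - (1 / 2 : ℝ) ^ (3 : ℕ)) ^ c with hr
  have hc1 : 1 ≤ c := le_trans (by norm_num) hc6
  have hc1' : (1 : ℝ) ≤ c := by exact_mod_cast hc1
  have hapos : 0 < a := by rw [ha74]; norm_num
  have hBpos : 0 < B := by rw [hB]; positivity
  have h2B : (1 : ℝ) ≤ 2 * B := by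
    rw [hB]
    have h1 : (1 : ℝ) ≤ Real.exp (1 + a) := Real.one_le_exp (by positivity)
    have hEc : (1 : ℝ) * 1 ≤ Real.exp (1 + a) * c :=
      mul_le_mul h1 hc1' zero_le_one (zero_le_one.trans h1)
    have hEca : (1 : ℝ) * 1 * (7 / 4) ≤ Real.exp (1 + a) * c * a :=
      mul_le_mul hEc ha74' (by norm_num) ((mul_nonneg zero_le_one zero_le_one).trans hEc)
    have h74 : (1 : ℝ) ≤ 2 * ((1 : ℝ) * 1 * (7 / 4)) := by norm_num
    exact h74.trans (by nlinarith [hEca])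
  have h2B4 : (1 : ℝ) ≤ (2 * B) ^ 4 := one_le_pow₀ h2B
  have hκpos : 0 < κ := by rw [hκ]; positivity
  have hκ1 : κ ≤ 1 := by
    rw [hκ, div_le_one (by positivity)]
    have h1a : (1 : ℝ) ≤ a := le_trans (by norm_num) ha74'
    exact le_trans h2B4 (le_mul_of_one_le_left (by positivity) h1a)
  have hr0 : 0 ≤ r := by
    rw [hr]
    have : (0 : ℝ) ≤ 1 - (1 / 2) ^ (3 : ℕ) := by norm_num
    positivity
  have hr1 : r < 1 := two_mul_pow_lt_one_of_density hc
  -- the rate is `ε = κ`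
  refine ⟨κ, hκpos, ?_⟩
  -- the failure probability bound `β n = r^n + 32 a B^4 / n → 0`
  set β : ℕ → ℝ := fun n => r ^ n + 32 * a * B ^ 4 / n with hβ
  have hβ0 : ∀ n, 0 ≤ β n := fun n => by rw [hβ]; positivity
  have hβlim : Tendsto β atTop (𝓝 0) := by
    have h1 := tendsto_pow_atTop_nhds_zero_of_lt_one hr0 hr1
    have h2 := tendsto_const_div_atTop_nhds_zero_nat (32 * a * B ^ 4)
    simpa using h1.add h2
  -- eventually, the event has mass `≥ 1 - β n`
  have hev : ∀ᶠ n : ℕ in atTop, 1 - ENNReal.ofReal (β n) ≤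
      (randomKCNF 3 n (c * n)).toOuterMeasure
        {φ | ¬ CNF.Satisfiable φ ∧ IsCoverExpander (cnfScopes φ) (κ * n) (7 / 4)} := by
    refine eventually_atTop.2 ⟨⌈(8 * 3 + 10) / κ⌉₊, fun n hn => ?_⟩
    have hκn : (8 * 3 + 10 : ℝ) ≤ κ * n := by
      have h1 : (8 * 3 + 10 : ℝ) / κ ≤ n := (Nat.le_ceil _).trans (by exact_mod_cast hn)
      rw [div_le_iff₀ hκpos] at h1
      linarith
    set N : ℕ := ⌊κ * n⌋₊ with hNdef
    have hNle : (N : ℝ) ≤ κ * n := Nat.floor_le (by positivity)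
    have hNge : κ * n - 1 < N := Nat.sub_one_lt_floor _
    have hnpos : (0 : ℝ) < n := by
      have : (0 : ℝ) < κ * n := by linarith
      exact pos_of_mul_pos_right this hκpos.le
    have hn1 : 1 ≤ n := by exact_mod_cast hnpos
    have hkn : 3 ≤ n := by
      have h33 : (33 : ℝ) < N := by linarith
      have : 33 < N := by exact_mod_cast h33
      have hNn : (N : ℝ) ≤ n := hNle.trans (by nlinarith)
      have : N ≤ n := by exact_mod_cast hNn
      omega
    have hK : (kClauses 3 n).Nonempty := by
      rw [← Finset.card_pos, card_kClauses]
      exact Nat.mul_pos (Nat.choose_pos hkn) (by positivity)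
    -- the expansion radius condition `a N ≤ n / (2B)^4`
    have haN : a * N ≤ n / (2 * B) ^ 4 := by
      calc a * N ≤ a * (κ * n) := mul_le_mul_of_nonneg_left hNle hapos.le
        _ = n / (2 * B) ^ 4 := by rw [hκ]; field_simp
    -- the bad tuples
    set badS : Finset (Fin (c * n) → ↥(kClauses 3 n)) :=
      univ.filter fun g => CNF.Satisfiable (List.ofFn fun i => (g i : Clause ℕ)) with hbadS
    set badE : Finset (Fin (c * n) → ↥(kClauses 3 n)) :=
      univ.filter fun g => ¬ IsCoverExpander (fun i => clauseScope (g i : Clause ℕ)) N a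
      with hbadE
    refine randomKCNF_toOuterMeasure_ge hK (hβ0 n) (badS ∪ badE) (fun g hg => ?_) ?_
    · -- good tuples are unsatisfiable expanders
      rw [Finset.mem_union, not_or] at hg
      have hns : ¬ CNF.Satisfiable (List.ofFn fun i => (g i : Clause ℕ)) := fun h =>
        hg.1 (mem_filter.2 ⟨mem_univ _, h⟩)
      have hexp : IsCoverExpander (fun i => clauseScope (g i : Clause ℕ)) N a := by
        by_contra h
        exact hg.2 (mem_filter.2 ⟨mem_univ _, h⟩)
      refine ⟨hns, ?_⟩
      have hexp' : IsCoverExpander (cnfScopes (List.ofFn fun i => (g i : Clause ℕ))) N a :=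
        hexp.cnfScopes_ofFn
      intro F hF
      have hFN : F.card ≤ N := Nat.le_floor hF
      have h1 := hexp' F (by exact_mod_cast hFN)
      rw [ha74] at h1
      exact h1
    · -- the count
      have hS := card_le_of_forall_satisfiable badS (fun g hg => (mem_filter.1 hg).2)
      have hE := card_le_of_forall_not_isCoverExpander_linear hk hc1 hn1 hK ha hB haN badE
        (fun g hg => (mem_filter.1 hg).2)
      have hKc : ((kClauses 3 n).card : ℝ) = (n.choose 3 : ℝ) * 2 ^ 3 := by
        rw [card_kClauses]; push_cast; ring
      have hSr : (badS.card : ℝ) ≤ r ^ n * ((((kClauses 3 n).card ^ (c * n) : ℕ)) : ℝ) := by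
        have hS' : badS.card ≤ 2 ^ n * (n.choose 3 * 7) ^ (c * n) := by simpa using hS
        have h1 : (badS.card : ℝ) ≤ 2 ^ n * ((n.choose 3 : ℝ) * 7) ^ (c * n) := by
          exact_mod_cast hS'
        refine h1.trans (le_of_eq ?_)
        have hbase : ((n.choose 3 : ℝ) * 7) =
            (1 - (1 / 2) ^ (3 : ℕ)) * ((n.choose 3 : ℝ) * 2 ^ 3) := by ring
        push_cast
        rw [hKc, hbase, mul_pow, pow_mul, hr]
        ring
      calc (((badS ∪ badE).card : ℕ) : ℝ) ≤ badS.card + badE.card := by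
            exact_mod_cast Finset.card_union_le _ _
        _ ≤ r ^ n * ((((kClauses 3 n).card ^ (c * n) : ℕ)) : ℝ) +
            32 * a * B ^ 4 / n * ((((kClauses 3 n).card ^ (c * n) : ℕ)) : ℝ) := add_le_add hSr hE
        _ = β n * ((((kClauses 3 n).card ^ (c * n) : ℕ)) : ℝ) := by rw [hβ]; ring
  -- squeeze
  have hβE : Tendsto (fun n => ENNReal.ofReal (β n)) atTop (𝓝 0) := by
    have := ENNReal.tendsto_ofReal hβlim
    rwa [ENNReal.ofReal_zero] at this
  have hlow : Tendsto (fun n => 1 - ENNReal.ofReal (β n)) atTop (𝓝 1) := by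
    have := ENNReal.Tendsto.sub (tendsto_const_nhds (x := (1 : ℝ≥0∞))) hβE
      (Or.inl ENNReal.one_ne_top)
    rwa [tsub_zero] at this
  refine tendsto_of_tendsto_of_tendsto_of_le_of_le' hlow tendsto_const_nhds hev
    (Eventually.of_forall fun n => ?_)
  exact (MeasureTheory.measure_mono (Set.subset_univ _)).trans_eq
    ((PMF.toOuterMeasure_apply_eq_one_iff _ _).2 (Set.subset_univ _))

end Summit.PneNP.PneNP.Theorems
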